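import Literature.Topology.FourManifolds.MMSWPictureOuterChart
import Literature.Topology.FourManifolds.MMSWRasmussenGeneralPosition
import HarnessLib

/-!
# The planar potential near the holes: radial monotonicity and the zone dichotomy

Topic `Literature/Topology/FourManifolds`; part of the proof of the named fact
`Literature.Topology.FourManifolds.pictureSurgeryPresentation` (`MMSWPictureSurgery.lean`; Kirby,
*The Topology of 4-Manifolds*, LNM 1374 (1989), Ch. I §2, Lemma 2.1).  Everything here is proved;
no named fact is introduced.

For the planar potential `g_k(z) = |z|²/R'_k² + Σ_j |z − c_j|⁻²` of the model boundary `M_k`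
(`MMSW.planarPot`) we prove:

* **radial monotonicity near a hole** (`exists_hasDerivAt_planarPot_ray`,
  `planarPot_ray_strictAntiOn`): along every ray `r ↦ c_j + r v`, `|v| = 1`, the potential is
  strictly decreasing for `0 < r ≤ 27/20` — the attraction `−2/r³` of the hole `j` beats the
  confinement term and the other holes, by the estimates of the zone analysis of
  `MMSWRasmussenGeneralPosition` (`gradC_ne_zero_of_near`), which we re-run keeping track of the
  sign of the radial component instead of the mere non-vanishing of the gradient;
* **the zone dichotomy** (`far_or_near_of_le_planarPot`): a planar point with `g_k(z) ≥ 19/20`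
  lies either in the far zone `|z| > R'_k/2` or within `27/20` of a (necessarily unique) hole
  centre (from `potential_lt_of_annulus`, `potential_lt_of_forall_le_dist`).

These facts organise the planar domain `{g_k < 1}` near its `k + 1` boundary curves into radial
collars, the supports of the compressions of the standard picture in the proof of
`pictureSurgeryPresentation`.

## References

* R. Kirby, *The Topology of 4-Manifolds*, LNM 1374 (1989), Ch. I §2. [Kirby1989]
* C. Manolescu, M. Marengon, S. Sarkar, M. Willis, Duke Math. J. 172 (2023), §8.1.
  [ManolescuMarengonSarkarWillis2023]
-/

open scoped Manifold ContDiff Topology Real ComplexConjugate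
open Function Set

noncomputable section

namespace Literature.Topology.FourManifolds

namespace MMSW

open Literature.AlgebraicTopology.Homotopy.HopfFibration (zC wC)

variable {k : ℕ}

/-! ## The near-zone estimate, with the sum of norms -/

/-- **Zone N (near a hole), quantitative form**: within distance `27/20` of the hole centre
`c_{j₁}` the confinement term plus the SUM of the norms of the other hole terms of the
half-gradient is `< (20/27)³ ≤` the norm of the `j₁`-th term.  (The estimate inside the tree's
`gradC_ne_zero_of_near`, restated.) [folklore] -/
theorem norm_conf_add_sum_norm_lt (Z : ℂ) (j₁ : Fin k) (hd : ‖Z - holeCentre k j₁‖ ≤ 27 / 20) :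
    ‖((bigRadius k ^ 2)⁻¹ : ℝ) • Z‖ +
      ∑ j ∈ Finset.univ.erase j₁,
        ‖((Complex.normSq (Z - holeCentre k j)) ^ 2)⁻¹ • (Z - holeCentre k j)‖ <
      ((27 / 20 : ℝ) ^ 3)⁻¹ := by
  classical
  set R : ℝ := bigRadius k with hR
  set t : Fin k → ℂ := fun j ↦ ((Complex.normSq (Z - holeCentre k j)) ^ 2)⁻¹ • (Z - holeCentre k j)
    with ht
  have hr1 : (1 : ℝ) ≤ k := by exact_mod_cast Nat.succ_le_of_lt (Fin.pos j₁)
  have hR80 : 80 ≤ R := by rw [hR, bigRadius]; linarith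
  -- the confinement term
  have hconf : ‖((R ^ 2)⁻¹ : ℝ) • Z‖ ≤ 1 / 800 := by
    rw [norm_smul, norm_inv, norm_pow, Real.norm_of_nonneg (by positivity)]
    have hZle : ‖Z‖ ≤ R / 10 := by
      have h1 : ‖Z‖ ≤ ‖Z - holeCentre k j₁‖ + ‖holeCentre k j₁‖ := norm_le_norm_sub_add Z _
      have h2 := norm_holeCentre_le j₁
      rw [hR, bigRadius]; linarith
    rw [inv_mul_le_iff₀ (by positivity)]
    nlinarith
  -- the other holes, folded
  set β : ℤ → ℝ := fun m ↦ ((max (4 * |(m : ℝ)| - 27 / 20) (53 / 20)) ^ 3)⁻¹ with hβ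
  have hβnn : ∀ m, 0 ≤ β m := fun m ↦ by simp only [hβ]; positivity
  have hterm : ∀ j ∈ Finset.univ.erase j₁, ‖t j‖ ≤ β ((j : ℤ) + 1 - ((j₁ : ℤ) + 1)) := by
    intro j hj
    have hne : j ≠ j₁ := Finset.ne_of_mem_erase hj
    have hsp := abs_re_sub_holeCentre_ge Z j₁ j hd
    have hm1 : (1 : ℝ) ≤ |(((j : ℤ) + 1 - ((j₁ : ℤ) + 1) : ℤ) : ℝ)| := by
      rw [← Int.cast_abs]
      have : (1 : ℤ) ≤ |((j : ℤ) + 1 - ((j₁ : ℤ) + 1))| := by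
        apply Int.one_le_abs
        intro h; apply hne; exact Fin.ext (by omega)
      exact_mod_cast this
    have hmax : max (4 * |(((j : ℤ) + 1 - ((j₁ : ℤ) + 1) : ℤ) : ℝ)| - 27 / 20) (53 / 20) =
        4 * |(((j : ℤ) + 1 - ((j₁ : ℤ) + 1) : ℤ) : ℝ)| - 27 / 20 := max_eq_left (by linarith)
    simp only [ht, hβ, hmax]
    refine norm_holeGradTerm_le (by linarith) (hsp.trans (Complex.abs_re_le_norm _))
  have hrest : ∑ j ∈ Finset.univ.erase j₁, ‖t j‖ ≤ 3 * ((53 / 20 : ℝ) ^ 3)⁻¹ + 1 / 48 := by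
    refine (Finset.sum_le_sum hterm).trans ?_
    refine (Finset.sum_le_sum_of_subset_of_nonneg (Finset.erase_subset j₁ Finset.univ)
      (fun j _ _ ↦ hβnn _)).trans ?_
    refine (sum_fin_le_fold β hβnn ((j₁ : ℤ) + 1) k).trans ?_
    have hβ0 : β 0 = ((53 / 20 : ℝ) ^ 3)⁻¹ := by
      simp only [hβ, Int.cast_zero, abs_zero, mul_zero, zero_sub]
      rw [max_eq_right (by norm_num)]
    have hβn : ∀ n : ℕ, β ((n : ℤ) + 1) + β (-((n : ℤ) + 1)) = 2 * ((4 * (n : ℝ) + 53 / 20) ^ 3)⁻¹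
        := by
      intro n
      have hn : (0 : ℝ) ≤ n := Nat.cast_nonneg n
      have e1 : |(((n : ℤ) + 1 : ℤ) : ℝ)| = (n : ℝ) + 1 := by
        push_cast; exact abs_of_nonneg (by positivity)
      have e2 : |((-((n : ℤ) + 1) : ℤ) : ℝ)| = (n : ℝ) + 1 := by
        push_cast; rw [abs_neg]; exact abs_of_nonneg (by positivity)
      simp only [hβ, e1, e2]
      rw [max_eq_left (by linarith)]
      ring
    rw [hβ0, Finset.sum_congr rfl fun n _ ↦ hβn n, ← Finset.mul_sum]
    have := sum_inv_cube_le (k + 1 + ((j₁ : ℤ) + 1).natAbs)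
    linarith
  have hnum : (1 : ℝ) / 800 + (3 * ((53 / 20 : ℝ) ^ 3)⁻¹ + 1 / 48) < ((27 / 20 : ℝ) ^ 3)⁻¹ := by
    norm_num
  linarith

/-! ## Derivatives of the potential along rays -/

/-- `d/dr |A + r v|² = 2 Re (v · conj (A + r v))`. [folklore] -/
theorem hasDerivAt_normSq_line (A v : ℂ) (r : ℝ) :
    HasDerivAt (fun r : ℝ ↦ Complex.normSq (A + r • v)) (2 * (v * conj (A + r • v)).re) r := by
  have hf : HasDerivAt (fun r : ℝ ↦ A + r • v) v r := by
    simpa using ((hasDerivAt_id r).smul_const v).const_add A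
  have h2 : HasDerivAt (fun r : ℝ ↦ ‖A + r • v‖ ^ 2) (2 * inner ℝ (A + r • v) v) r := hf.norm_sq
  simp_rw [← Complex.normSq_eq_norm_sq, Complex.inner] at h2
  exact h2

/-- `d/dr |A + r v|⁻² = −2 Re (v · conj (A + r v)) / |A + r v|⁴` off the pole. [folklore] -/
theorem hasDerivAt_inv_normSq_line (A v : ℂ) (r : ℝ) (h : A + r • v ≠ 0) :
    HasDerivAt (fun r : ℝ ↦ 1 / Complex.normSq (A + r • v))
      (-(2 * (v * conj (A + r • v)).re) / Complex.normSq (A + r • v) ^ 2) r := by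
  have hN : Complex.normSq (A + r • v) ≠ 0 := by rwa [Ne, Complex.normSq_eq_zero]
  refine ((hasDerivAt_const r (1 : ℝ)).div (hasDerivAt_normSq_line A v r) hN).congr_deriv ?_
  ring

/-- `Re (v · conj X) ≤ |v| |X|`. [folklore] -/
theorem re_mul_conj_le (v X : ℂ) : (v * conj X).re ≤ ‖v‖ * ‖X‖ := by
  calc (v * conj X).re ≤ ‖v * conj X‖ := Complex.re_le_norm _
    _ = ‖v‖ * ‖X‖ := by rw [norm_mul, Complex.norm_conj]

/-- `|Re (v · conj X)| ≤ |v| |X|`. [folklore] -/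
theorem abs_re_mul_conj_le (v X : ℂ) : |(v * conj X).re| ≤ ‖v‖ * ‖X‖ := by
  calc |(v * conj X).re| ≤ ‖v * conj X‖ := Complex.abs_re_le_norm _
    _ = ‖v‖ * ‖X‖ := by rw [norm_mul, Complex.norm_conj]

/-- Distinct hole centres are at distance `≥ 4`. [folklore] -/
theorem four_le_norm_holeCentre_sub {i j : Fin k} (hij : i ≠ j) :
    4 ≤ ‖holeCentre k i - holeCentre k j‖ := by
  have h : holeCentre k i - holeCentre k j = (((4 * (((i : ℕ) : ℝ) - ((j : ℕ) : ℝ)) : ℝ)) : ℂ) := by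
    apply Complex.ext
    · simp only [Complex.sub_re, holeCentre_re, Complex.ofReal_re]; ring
    · simp only [Complex.sub_im, holeCentre_im, Complex.ofReal_im, sub_zero]
  rw [h, Complex.norm_real, Real.norm_eq_abs, abs_mul, abs_of_pos (by norm_num : (0:ℝ) < 4)]
  have hne : ((i : ℕ) : ℝ) ≠ ((j : ℕ) : ℝ) := by
    intro h'; exact hij (Fin.ext (by exact_mod_cast h'))
  have h1 : (1 : ℝ) ≤ |((i : ℕ) : ℝ) - ((j : ℕ) : ℝ)| := by
    rcases lt_or_gt_of_ne hne with h' | h'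
    · have : (i : ℕ) < (j : ℕ) := by exact_mod_cast h'
      have : ((i : ℕ) : ℝ) + 1 ≤ ((j : ℕ) : ℝ) := by exact_mod_cast this
      rw [abs_of_neg (by linarith)]; linarith
    · have : (j : ℕ) < (i : ℕ) := by exact_mod_cast h'
      have : ((j : ℕ) : ℝ) + 1 ≤ ((i : ℕ) : ℝ) := by exact_mod_cast this
      rw [abs_of_pos (by linarith)]; linarith
  linarith

/-- A point within `< 4` of one hole centre... precisely: a point at distance `≤ 27/20` from
`c_{j₁}` is at distance `≥ 53/20` from every other centre, in particular off all the poles.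
[folklore] -/
theorem norm_sub_holeCentre_ge_of_near {Z : ℂ} {j₁ : Fin k} (hd : ‖Z - holeCentre k j₁‖ ≤ 27 / 20)
    {j : Fin k} (hj : j ≠ j₁) : 53 / 20 ≤ ‖Z - holeCentre k j‖ := by
  have h4 := four_le_norm_holeCentre_sub (k := k) hj.symm
  have htri : ‖holeCentre k j₁ - holeCentre k j‖ ≤ ‖Z - holeCentre k j₁‖ + ‖Z - holeCentre k j‖ :=
    calc ‖holeCentre k j₁ - holeCentre k j‖ ≤ ‖holeCentre k j₁ - Z‖ + ‖Z - holeCentre k j‖ :=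
          norm_sub_le_norm_sub_add_norm_sub _ _ _
      _ = ‖Z - holeCentre k j₁‖ + ‖Z - holeCentre k j‖ := by rw [norm_sub_rev]
  linarith

/-- **The radial derivative of the potential near a hole is negative**: along the ray
`r ↦ c_{j₁} + r v`, `|v| = 1`, for `0 < r ≤ 27/20`, `g_k` has derivative
`≤ 2 (20/27)³ − 2/r³ < 0`. [folklore] -/
theorem exists_hasDerivAt_planarPot_ray (j₁ : Fin k) {v : ℂ} (hv : ‖v‖ = 1) {r : ℝ} (hr0 : 0 < r)
    (hr : r ≤ 27 / 20) :
    ∃ d : ℝ, HasDerivAt (fun r : ℝ ↦ planarPot k (holeCentre k j₁ + r • v)) d r ∧ d < 0 := by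
  classical
  set Z : ℂ := holeCentre k j₁ + r • v with hZ
  have hv0 : v ≠ 0 := by rw [← norm_ne_zero_iff, hv]; norm_num
  have hZj₁ : Z - holeCentre k j₁ = r • v := by rw [hZ]; ring
  have hdist : ‖Z - holeCentre k j₁‖ = r := by
    rw [hZj₁, norm_smul, hv, mul_one, Real.norm_of_nonneg hr0.le]
  have hd : ‖Z - holeCentre k j₁‖ ≤ 27 / 20 := by rw [hdist]; exact hr
  -- off all the poles
  have hne : ∀ j : Fin k, holeCentre k j₁ - holeCentre k j + r • v ≠ 0 := by
    intro j
    have hrew : holeCentre k j₁ - holeCentre k j + r • v = Z - holeCentre k j := by rw [hZ]; ring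
    rw [hrew]
    by_cases hj : j = j₁
    · rw [hj, hZj₁]; exact smul_ne_zero hr0.ne' hv0
    · rw [← norm_pos_iff]
      linarith [norm_sub_holeCentre_ge_of_near hd hj]
  -- the derivative of each hole term
  have hterm : ∀ j : Fin k, HasDerivAt (fun r : ℝ ↦ 1 / Complex.normSq (holeCentre k j₁ + r • v -
      holeCentre k j)) (-(2 * (v * conj (Z - holeCentre k j)).re) /
        Complex.normSq (Z - holeCentre k j) ^ 2) r := by
    intro j
    have hrew : ∀ r' : ℝ, holeCentre k j₁ + r' • v - holeCentre k j =
        (holeCentre k j₁ - holeCentre k j) + r' • v := fun r' ↦ by ring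
    simp_rw [hrew]
    have h := hasDerivAt_inv_normSq_line (holeCentre k j₁ - holeCentre k j) v r (hne j)
    have hrew' : holeCentre k j₁ - holeCentre k j + r • v = Z - holeCentre k j := by rw [hZ]; ring
    rw [hrew'] at h
    exact h
  have hconfD : HasDerivAt (fun r : ℝ ↦ Complex.normSq (holeCentre k j₁ + r • v) / bigRadius k ^ 2)
      (2 * (v * conj Z).re / bigRadius k ^ 2) r :=
    (hasDerivAt_normSq_line (holeCentre k j₁) v r).div_const _
  have hsum := HasDerivAt.fun_sum (u := (Finset.univ : Finset (Fin k))) fun j _ ↦ hterm j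
  refine ⟨2 * (v * conj Z).re / bigRadius k ^ 2 + ∑ j : Fin k,
    -(2 * (v * conj (Z - holeCentre k j)).re) / Complex.normSq (Z - holeCentre k j) ^ 2, ?_, ?_⟩
  · simp only [planarPot_eq_bigRadius]
    exact hconfD.add hsum
  -- the sign
  have hR := bigRadius_pos (k := k)
  -- split off the `j₁` term: it is `-2/r³`
  rw [← Finset.add_sum_erase Finset.univ _ (Finset.mem_univ j₁)]
  have hj₁ : -(2 * (v * conj (Z - holeCentre k j₁)).re) / Complex.normSq (Z - holeCentre k j₁) ^ 2 =
      -(2 / r ^ 3) := by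
    rw [hZj₁]
    have h1 : (v * conj (r • v)).re = r := by
      rw [Complex.real_smul, map_mul, Complex.conj_ofReal, ← mul_assoc, mul_comm v, mul_assoc,
        Complex.re_ofReal_mul, Complex.mul_conj, ← Complex.sq_norm, hv]
      simp
    have h2 : Complex.normSq (r • v) = r ^ 2 := by
      rw [Complex.normSq_eq_norm_sq, norm_smul, hv, mul_one, Real.norm_of_nonneg hr0.le]
    rw [h1, h2]
    field_simp
  rw [hj₁]
  -- bound the confinement term and the other hole terms by norms
  have hconf : 2 * (v * conj Z).re / bigRadius k ^ 2 ≤ 2 * ‖((bigRadius k ^ 2)⁻¹ : ℝ) • Z‖ := by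
    rw [norm_smul, norm_inv, norm_pow, Real.norm_of_nonneg hR.le, div_eq_mul_inv]
    have := re_mul_conj_le v Z
    rw [hv, one_mul] at this
    have hi : 0 ≤ (bigRadius k ^ 2)⁻¹ := by positivity
    nlinarith
  have hothers : ∀ j ∈ Finset.univ.erase j₁,
      -(2 * (v * conj (Z - holeCentre k j)).re) / Complex.normSq (Z - holeCentre k j) ^ 2 ≤
        2 * ‖((Complex.normSq (Z - holeCentre k j)) ^ 2)⁻¹ • (Z - holeCentre k j)‖ := by
    intro j _
    rw [norm_smul, norm_inv, norm_pow, Real.norm_of_nonneg (Complex.normSq_nonneg _), neg_div,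
      div_eq_mul_inv]
    have h1 := abs_le.1 (abs_re_mul_conj_le v (Z - holeCentre k j))
    rw [hv, one_mul] at h1
    have hi : 0 ≤ (Complex.normSq (Z - holeCentre k j) ^ 2)⁻¹ := by positivity
    nlinarith [h1.1]
  have hkey := norm_conf_add_sum_norm_lt Z j₁ hd
  have hsumle := Finset.sum_le_sum hothers
  rw [← Finset.mul_sum] at hsumle
  -- `1/r³ ≥ (20/27)³`
  have hr3 : ((27 / 20 : ℝ) ^ 3)⁻¹ ≤ (r ^ 3)⁻¹ := by
    apply inv_anti₀ (pow_pos hr0 3)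
    exact pow_le_pow_left₀ hr0.le hr 3
  have h2r : 2 / r ^ 3 = 2 * (r ^ 3)⁻¹ := by rw [div_eq_mul_inv]
  rw [h2r]
  linarith

/-- **Radial strict monotonicity near a hole**: `r ↦ g_k(c_j + r v)` is strictly decreasing on
`(0, 27/20]` (`|v| = 1`). [folklore] -/
theorem planarPot_ray_strictAntiOn (j : Fin k) {v : ℂ} (hv : ‖v‖ = 1) :
    StrictAntiOn (fun r : ℝ ↦ planarPot k (holeCentre k j + r • v)) (Ioc 0 (27 / 20)) := by
  have hderiv : ∀ r ∈ Ioc (0 : ℝ) (27 / 20), ∃ d : ℝ,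
      HasDerivAt (fun r : ℝ ↦ planarPot k (holeCentre k j + r • v)) d r ∧ d < 0 := fun r hr ↦
    exists_hasDerivAt_planarPot_ray j hv hr.1 hr.2
  have hcont : ContinuousOn (fun r : ℝ ↦ planarPot k (holeCentre k j + r • v)) (Ioc 0 (27 / 20)) :=
    fun r hr ↦ (hderiv r hr).choose_spec.1.continuousAt.continuousWithinAt
  refine strictAntiOn_of_deriv_neg (convex_Ioc 0 (27 / 20)) hcont fun r hr ↦ ?_
  rw [interior_Ioc] at hr
  obtain ⟨d, hd, hdneg⟩ := hderiv r ⟨hr.1, hr.2.le⟩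
  rwa [hd.deriv]

/-- The value of the potential within distance `1` of a hole exceeds `1`:
`g_k(z) ≥ |z − c_j|⁻² ≥ 1`. [folklore] -/
theorem one_le_planarPot_of_norm_le_one {Z : ℂ} {j : Fin k} (h0 : Z ≠ holeCentre k j)
    (h1 : ‖Z - holeCentre k j‖ ≤ 1) : 1 ≤ planarPot k Z := by
  rw [planarPot_eq_bigRadius]
  have hpos : 0 < Complex.normSq (Z - holeCentre k j) := Complex.normSq_pos.2 (sub_ne_zero.2 h0)
  have hle : Complex.normSq (Z - holeCentre k j) ≤ 1 := by
    rw [Complex.normSq_eq_norm_sq]; nlinarith [norm_nonneg (Z - holeCentre k j)]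
  have hterm : 1 ≤ 1 / Complex.normSq (Z - holeCentre k j) := by
    rw [le_div_iff₀ hpos]; linarith
  have hsum : 1 / Complex.normSq (Z - holeCentre k j) ≤
      ∑ i : Fin k, 1 / Complex.normSq (Z - holeCentre k i) :=
    Finset.single_le_sum (f := fun i ↦ 1 / Complex.normSq (Z - holeCentre k i))
      (fun i _ ↦ one_div_nonneg.2 (Complex.normSq_nonneg _)) (Finset.mem_univ j)
  have h0' : 0 ≤ Complex.normSq Z / bigRadius k ^ 2 :=
    div_nonneg (Complex.normSq_nonneg _) (sq_nonneg _)
  linarith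

/-! ## The zone dichotomy -/

/-- **The zone dichotomy**: a planar point with `g_k(z) ≥ 19/20` lies in the far zone
`|z| > R'_k/2` or within `27/20` of a hole centre. [folklore] -/
theorem far_or_near_of_le_planarPot {Z : ℂ} (hg : 19 / 20 ≤ planarPot k Z) :
    bigRadius k / 2 < ‖Z‖ ∨ ∃ j : Fin k, ‖Z - holeCentre k j‖ < 27 / 20 := by
  by_contra h
  push Not at h
  obtain ⟨hfar, hnear⟩ := h
  have hpot : planarPot k Z = Complex.normSq Z / (40 * ((k : ℝ) + 1)) ^ 2 +
      ∑ j : Fin k, (Complex.normSq (Z - holeCentre k j))⁻¹ := by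
    rw [planarPot]; simp_rw [one_div]
  rw [bigRadius] at hfar
  rcases le_or_gt (40 * ((k : ℝ) + 1) / 8) ‖Z‖ with h8 | h8
  · have := potential_lt_of_annulus Z h8 hfar
    rw [← hpot] at this
    linarith
  · have := potential_lt_of_forall_le_dist Z h8.le hnear
    rw [← hpot] at this
    linarith

/-- The near zones of distinct holes are disjoint: a point within `2` of `c_i` and within `2` of
`c_j` forces `i = j`. [folklore] -/
theorem eq_of_norm_sub_holeCentre_lt {Z : ℂ} {i j : Fin k} (hi : ‖Z - holeCentre k i‖ < 2)
    (hj : ‖Z - holeCentre k j‖ < 2) : i = j := by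
  by_contra hij
  have h4 := four_le_norm_holeCentre_sub (k := k) hij
  have htri : ‖holeCentre k i - holeCentre k j‖ ≤ ‖Z - holeCentre k i‖ + ‖Z - holeCentre k j‖ :=
    calc ‖holeCentre k i - holeCentre k j‖ ≤ ‖holeCentre k i - Z‖ + ‖Z - holeCentre k j‖ :=
          norm_sub_le_norm_sub_add_norm_sub _ _ _
      _ = ‖Z - holeCentre k i‖ + ‖Z - holeCentre k j‖ := by rw [norm_sub_rev]
  linarith

/-- In the near zone of a hole the point is close to the origin: `|z| ≤ 4k + 27/20 < R'_k/2`.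
[folklore] -/
theorem norm_lt_of_near {Z : ℂ} {j : Fin k} (hj : ‖Z - holeCentre k j‖ < 27 / 20) :
    ‖Z‖ < bigRadius k / 2 := by
  have h1 : ‖Z‖ ≤ ‖Z - holeCentre k j‖ + ‖holeCentre k j‖ := norm_le_norm_sub_add Z _
  have h2 := norm_holeCentre_le (r := k) j
  rw [bigRadius]
  have hk : (0 : ℝ) ≤ k := Nat.cast_nonneg k
  linarith

end MMSW

end Literature.Topology.FourManifolds
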